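import Summits.AtomisticToContinuum.FouriersLaw.Theorems.JunctionLocalityNonBallisticStubDrudeFromTruncationRegularAux1
import Summits.AtomisticToContinuum.FouriersLaw.Theorems.EmbeddedDrudeMourreAbelThermodynamicLimitFixedTimeOffsetMatchingSeveredLimit
import Literature.Analysis.FunctionSpaces.WeakCompactnessL1Proofs
import Literature.MathematicalPhysics.KineticTheory.InfiniteChainL2Locality
import Literature.MathematicalPhysics.KineticTheory.InfiniteChainGeneratorLipschitz
import Literature.MathematicalPhysics.KineticTheory.InfiniteChainTwoPointContinuity
import Literature.MathematicalPhysics.KineticTheory.InfiniteChainSeveredGibbs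

/-!
# Stub `stub_drudeFromTruncationRegular` (DFT′) of line `drude-controls-conductance` (R3b) — crux
`JunctionLocality.NonBallistic` (stmt-AtomisticToContinuum-9127), part 2: the clipped current as a local
observable of `ℋ₀`

Helper file (`--supports stmt-AtomisticToContinuum-9127`); nothing here closes the item.

For a chain `P` with even polynomial `U, V`, a dynamics `D` with carrier `𝒳₀` which is the identity off
`𝒳₀`, and a shift-invariant DLR state `μ` with Buttà–Marchioro's superstability estimate, preserved by
`D` and exponentially `ρ`-mixing:

* §1 the clipped current `a_M = clip_M ∘ j₀`: local, bounded, with the fixed-time `L²` locality of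
  `a_M ∘ φ_t` (summable rate, `exists_summable_l2_locality`) and continuous two-point functions;
* §2 `exists_zeroWavenumberData_clipCurrent`: Doyon's zero-wavenumber data with generators
  `{j₀, h₀, a_M}`, and the strong continuity of its Koopman group (part 1 + the tree's
  `continuous_integral_count_cov_flow`, `isStronglyContinuous_of_generators`);
* the registered sub-goal `stub_zeroWavenumberDataClipCurrent` (= §2, closed form).
-/

noncomputable section

namespace Summit.AtomisticToContinuum.FouriersLaw.Theorems.NonBallistic.DrudeFromTruncation

open MeasureTheory ProbabilityTheory Filter Topology Set Function
open scoped NNReal ENNReal InnerProductSpace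
open Literature.MathematicalPhysics.KineticTheory
open Literature.MathematicalPhysics.KineticTheory.HeatConduction

/-! ### §1 The clip and the clipped current -/

-- The clip `clip_M(u) = max(-M, min(M, u))`: `|clip_M u| ≤ M` is `Literature.Analysis.FunctionSpaces.abs_max_neg_min_le`,
-- the `1`-Lipschitz bound is `Literature.Analysis.FunctionSpaces.abs_clamp_sub_clamp_le`, and `|u - clip_M u| ≤ u²/M` is
-- `…AbelThermodynamicLimit.LoomisCompactHorizonWitness.abs_sub_clamp_le_sq_div` (all landed; reused below).

/-- The clip is continuous. [folklore] -/
theorem continuous_clip (M : ℝ) : Continuous fun u : ℝ => max (-M) (min M u) :=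
  continuous_const.max (continuous_const.min continuous_id)

section ClipCurrent

variable (P : OscillatorChain)

/-- The clipped current `a_M = clip_M ∘ j_x` is measurable. [folklore] -/
theorem measurable_clipCurrent (M : ℝ) (x : ℤ) :
    Measurable fun σ : ChainConfig => max (-M) (min M (P.bondCurrentZ σ x)) :=
  measurable_const.max (measurable_const.min (measurable_bondCurrentZ P x))

/-- `a_M = clip_M ∘ j₀` reads the sites of `[-1, 1]`. [folklore] -/
theorem dependsOn_clipCurrent (M : ℝ) :
    DependsOn (fun σ : ChainConfig => max (-M) (min M (P.bondCurrentZ σ 0))) (Icc (-1 : ℤ) 1) := by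
  intro σ σ' h
  have e : P.bondCurrentZ σ 0 = P.bondCurrentZ σ' 0 := P.dependsOn_bondCurrentZ_zero h
  show max (-M) (min M (P.bondCurrentZ σ 0)) = max (-M) (min M (P.bondCurrentZ σ' 0))
  rw [e]

/-- `clip_M ∘ j₀ ∘ τ_x = clip_M ∘ j_x`. [folklore] -/
theorem clipCurrent_comp_chainShift (M : ℝ) (x : ℤ) :
    (fun σ : ChainConfig => max (-M) (min M (P.bondCurrentZ σ 0))) ∘ chainShift x =
      fun σ : ChainConfig => max (-M) (min M (P.bondCurrentZ σ x)) := by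
  funext σ
  simp only [comp_apply, OscillatorChain.bondCurrentZ_chainShift, zero_add]

variable {P}

/-- The clipped current is in every `L^p` of a finite measure (`|a_M| ≤ M`). [folklore] -/
theorem memLp_clipCurrent {μ : Measure ChainConfig} [IsFiniteMeasure μ] {M : ℝ} (hM : 0 ≤ M) (x : ℤ)
    (p : ℝ≥0∞) : MemLp (fun σ : ChainConfig => max (-M) (min M (P.bondCurrentZ σ x))) p μ :=
  MemLp.of_bound (measurable_clipCurrent P M x).aestronglyMeasurable M
    (Eventually.of_forall fun σ => by
      rw [Real.norm_eq_abs]; exact Literature.Analysis.FunctionSpaces.abs_max_neg_min_le hM _)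

/-- Fourth moments of the clipped current. [folklore] -/
theorem integrable_clipCurrent_pow_four {μ : Measure ChainConfig} [IsFiniteMeasure μ] {M : ℝ}
    (hM : 0 ≤ M) (x : ℤ) :
    Integrable (fun σ : ChainConfig => max (-M) (min M (P.bondCurrentZ σ x)) ^ 4) μ := by
  refine (integrable_const (M ^ 4)).mono' ((measurable_clipCurrent P M x).pow_const 4).aestronglyMeasurable
    (Eventually.of_forall fun σ => ?_)
  rw [Real.norm_eq_abs, abs_pow]
  exact pow_le_pow_left₀ (abs_nonneg _) (Literature.Analysis.FunctionSpaces.abs_max_neg_min_le hM _) 4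

/-- **Fixed-time `L²` locality of the clipped current** with summable rate, uniformly on `|t| ≤ τ`
(`exists_summable_l2_locality`: the clip is `1`-Lipschitz, so `a_M` inherits the polynomial Lipschitz
bound of `j₀`). [folklore] -/
theorem exists_l2_locality_clipCurrent {s₁ s₂ : ℕ} (hs₁ : 1 ≤ s₁) (hs₂ : 1 ≤ s₂)
    (hU1 : OscillatorChain.IsEvenPolyOfDegree P.U s₁) (hV1 : OscillatorChain.IsEvenPolyOfDegree P.V s₂)
    (D : InfiniteChainDynamics P) (hcar : D.carrier = P.bmGood) {T : ℝ} {μ : Measure ChainConfig}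
    (hG : P.IsChainGibbsMeasure T μ) (hss : P.HasSuperstabilityEstimate μ) (hD : D.PreservesMeasure μ)
    {M : ℝ} (hM : 0 ≤ M) :
    ∀ τ : ℝ, 0 ≤ τ → ∃ ε : ℕ → ℝ, (∀ n, 0 ≤ ε n) ∧ Summable ε ∧ ∀ t : ℝ, |t| ≤ τ → ∀ n : ℕ,
      ∃ g : ChainConfig → ℝ, DependsOn g (Icc (-(n : ℤ) - 1) (n + 1)) ∧ Measurable g ∧ MemLp g 2 μ ∧
        Real.sqrt (∫ σ, ((fun σ : ChainConfig => max (-M) (min M (P.bondCurrentZ σ 0))) (D.flow t σ) -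
          g σ) ^ 2 ∂μ) ≤ ε n := by
  haveI : IsProbabilityMeasure μ := hss.1
  have hU0 : ∀ r, 0 ≤ P.U r := hU1.choose_spec.2.2
  have hV0 : ∀ r, 0 ≤ P.V r := hV1.choose_spec.2.2
  have hU : ContDiff ℝ 2 P.U := hU1.contDiff_two
  have hV : ContDiff ℝ 2 P.V := hV1.contDiff_two
  have hB1 : P.CondB1 :=
    OscillatorChain.condB1_of_bddBelow _ hU hV ⟨0, by rintro _ ⟨q, rfl⟩; exact hU0 q⟩
      ⟨0, by rintro _ ⟨r, rfl⟩; exact hV0 r⟩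
  have hsev : ∀ (n : ℕ) (t : ℝ), MeasurePreserving
      (OscillatorChain.severedFlow hB1 (Finset.Icc ((0 : ℤ) - n) ((0 : ℤ) + n)) t) μ μ := fun n t =>
    OscillatorChain.measurePreserving_severedFlow_of_isChainGibbsMeasure hU hV hB1 _ hG t
  obtain ⟨Ca, hCa, hL⟩ := OscillatorChain.exists_polyLipschitz_bondCurrentZ hV1
  have hLa : ∀ (σ σ' : ChainConfig) (R δ : ℝ), 1 ≤ R → 0 ≤ δ → δ ≤ 1 →
      (∀ i : ℤ, -1 ≤ i → i ≤ 1 → |(σ' i).1| ≤ R ∧ |(σ' i).2| ≤ R ∧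
        |(σ i).1 - (σ' i).1| ≤ δ ∧ |(σ i).2 - (σ' i).2| ≤ δ) →
      |max (-M) (min M (P.bondCurrentZ σ 0)) - max (-M) (min M (P.bondCurrentZ σ' 0))| ≤
        Ca * R ^ (2 * s₂ + 1) * δ :=
    fun σ σ' R δ hR hδ0 hδ1 h =>
      (Literature.Analysis.FunctionSpaces.abs_clamp_sub_clamp_le M _ _).trans (hL σ σ' R δ hR hδ0 hδ1 h)
  intro τ hτ
  obtain ⟨ε, hε0, hε, hmain⟩ := D.exists_summable_l2_locality hs₁ hs₂ hU1 hV1 hcar hB1 hss hD hsev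
    (measurable_clipCurrent P M 0) (dependsOn_clipCurrent P M) (memLp_clipCurrent hM 0 2)
    (integrable_clipCurrent_pow_four hM 0) hCa hLa τ hτ
  refine ⟨ε, hε0, hε, fun t ht n => ?_⟩
  obtain ⟨h1, h2, h3, h4⟩ := hmain t ht n
  exact ⟨_, h1, h2, h3, h4⟩

/-- **Continuity in time of the two-point functions of the clipped current**,
`t ↦ ∫ a_M · (a_M ∘ τ_x ∘ φ_t) dμ` (bounded integrands, orbits continuous in time). [folklore] -/
theorem continuous_integral_clipCurrent_mul_flow {s₂ : ℕ} (hV1 : OscillatorChain.IsEvenPolyOfDegree P.V s₂)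
    (D : InfiniteChainDynamics P) {μ : Measure ChainConfig} [IsProbabilityMeasure μ]
    (hD : D.PreservesMeasure μ) {M : ℝ} (hM : 0 ≤ M) (x : ℤ) :
    Continuous fun t : ℝ => ∫ σ, max (-M) (min M (P.bondCurrentZ σ 0)) *
      max (-M) (min M (P.bondCurrentZ (chainShift x (D.flow t σ)) 0)) ∂μ := by
  have hVc' : Continuous (deriv P.V) := hV1.contDiff_two.continuous_deriv (by norm_num)
  have h := D.continuous_integral_mul_comp_flow hD (f := fun σ => max (-M) (min M (P.bondCurrentZ σ 0)))
    (g := fun σ => max (-M) (min M (P.bondCurrentZ σ x))) (measurable_clipCurrent P M 0)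
    (measurable_clipCurrent P M x) (integrable_clipCurrent_pow_four hM 0)
    (integrable_clipCurrent_pow_four hM x) fun σ hσ =>
      (continuous_clip M).comp (D.continuous_bondCurrentZ_flow hVc' hσ x)
  simp only [OscillatorChain.bondCurrentZ_chainShift, zero_add]
  exact h

/-- **Continuity in time of the truncated autocorrelation terms** `t ↦ Cov_μ(a, (a ∘ φ_t) ∘ τ_x)` for a
bounded... rather, square-integrable measurable `a` whose two-point functions are continuous (the flow
commutes everywhere with the translations and preserves `μ`). [folklore]
-- adapted from the step `hterm_cont` of `InfiniteChainDynamics.continuous_integral_count_cov_flow` -/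
theorem continuous_cov_flow_chainShift (D : InfiniteChainDynamics P) (hU0 : ∀ r, 0 ≤ P.U r)
    (hV0 : ∀ r, 0 ≤ P.V r) (hcar : D.carrier = P.bmGood)
    (hid : ∀ (t : ℝ) (σ : ChainConfig), σ ∉ P.bmGood → D.flow t σ = σ)
    {μ : Measure ChainConfig} [IsProbabilityMeasure μ]
    (hτ : ∀ x : ℤ, MeasurePreserving (chainShift x) μ μ) (hD : D.PreservesMeasure μ)
    {a : ChainConfig → ℝ} (ham : Measurable a) (ha2 : MemLp a 2 μ)
    (hcont : ∀ x : ℤ, Continuous fun t : ℝ => ∫ σ, a σ * a (chainShift x (D.flow t σ)) ∂μ) (x : ℤ) :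
    Continuous fun t : ℝ => cov[a, (a ∘ D.flow t) ∘ chainShift x; μ] := by
  have hterm : ∀ t : ℝ, cov[a, (a ∘ D.flow t) ∘ chainShift x; μ] =
      (∫ σ, a σ * a (chainShift x (D.flow t σ)) ∂μ) - (∫ σ, a σ ∂μ) * ∫ σ, a (chainShift x σ) ∂μ := by
    intro t
    have hpt : (a ∘ D.flow t) ∘ chainShift x = (a ∘ chainShift x) ∘ D.flow t := by
      funext σ
      simp only [comp_apply]
      rw [D.flow_chainShift_of_eq_id hcar hid hU0 hV0 t x σ]
    have hax2 : MemLp (a ∘ chainShift x) 2 μ := ha2.comp_measurePreserving (hτ x)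
    have haxt2 : MemLp ((a ∘ chainShift x) ∘ D.flow t) 2 μ := hax2.comp_measurePreserving (hD.2 t)
    rw [hpt, covariance_eq_sub ha2 haxt2]
    have hmean : ∫ σ, ((a ∘ chainShift x) ∘ D.flow t) σ ∂μ = ∫ σ, a (chainShift x σ) ∂μ := by
      have hm' : AEStronglyMeasurable (a ∘ chainShift x) (μ.map (D.flow t)) := by
        rw [(hD.2 t).map_eq]
        exact (ham.comp (chainShift.measurable x)).aestronglyMeasurable
      have h := integral_map (hD.2 t).measurable.aemeasurable hm'
      rw [(hD.2 t).map_eq] at h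
      exact h.symm
    rw [hmean]
    rfl
  simp only [hterm]
  exact (hcont x).sub continuous_const

end ClipCurrent

/-! ### §2 Zero-wavenumber data containing the clipped current, with strongly continuous Koopman group -/

/-- **Doyon's `ℋ₀` with the clipped current as a local observable.** Let `U`, `V` be even non-negative
polynomials of degrees `2s₁, 2s₂ ≥ 2`, `D` a dynamics with carrier `𝒳₀` which is the identity off `𝒳₀`,
`μ` a shift-invariant DLR state with Buttà–Marchioro's superstability estimate (2.3), preserved by `D` and
exponentially `ρ`-mixing between half-lines. For every `M > 0` there is a zero-wavenumber datum `Z` for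
`(P, D)` with state `μ`, whose local observables contain the clipped current `a_M = clip_M ∘ j₀` (they are
spanned by the translates and time-evolutes of `j₀, h₀, a_M`), and whose Koopman group on `ℋ₀` is strongly
continuous (summable clustering of the generators from (M) + fixed-time `L²` locality; continuity of the
summed autocorrelations of the three generators). [folklore] -/
theorem exists_zeroWavenumberData_clipCurrent {P : OscillatorChain} {s₁ s₂ : ℕ} (hs₁ : 1 ≤ s₁)
    (hs₂ : 1 ≤ s₂) (hU1 : OscillatorChain.IsEvenPolyOfDegree P.U s₁)
    (hV1 : OscillatorChain.IsEvenPolyOfDegree P.V s₂) (D : InfiniteChainDynamics P)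
    (hcar : D.carrier = P.bmGood) (hid : ∀ (t : ℝ) (σ : ChainConfig), σ ∉ P.bmGood → D.flow t σ = σ)
    {T : ℝ} {μ : Measure ChainConfig} (hG : P.IsChainGibbsMeasure T μ) (hS : IsShiftInvariant μ)
    (hss : P.HasSuperstabilityEstimate μ) (hD : D.PreservesMeasure μ) {C m : ℝ} (hC : 0 ≤ C) (hm : 0 < m)
    (hmix : ∀ (a : ℤ) (n : ℕ) (f g : ChainConfig → ℝ),
      DependsOn f {i : ℤ | i ≤ a} → DependsOn g {i : ℤ | a + n ≤ i} → Measurable f → Measurable g →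
      MemLp f 2 μ → MemLp g 2 μ →
      |∫ σ, f σ * g σ ∂μ - (∫ σ, f σ ∂μ) * ∫ σ, g σ ∂μ| ≤
        C * Real.exp (-(m * n)) * (∫ σ, f σ ^ 2 ∂μ) ^ (1 / 2 : ℝ) * (∫ σ, g σ ^ 2 ∂μ) ^ (1 / 2 : ℝ))
    {M : ℝ} (hM : 0 < M) :
    ∃ Z : ZeroWavenumberData P D, Z.μ = μ ∧
      (fun σ : ChainConfig => max (-M) (min M (P.bondCurrentZ σ 0))) ∈ Z.localObs ∧
      Z.toFluctuationDynamics.IsStronglyContinuous := by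
  haveI : IsProbabilityMeasure μ := hss.1
  have hU0 : ∀ r, 0 ≤ P.U r := hU1.choose_spec.2.2
  have hV0 : ∀ r, 0 ≤ P.V r := hV1.choose_spec.2.2
  have hU : ContDiff ℝ 2 P.U := hU1.contDiff_two
  have hV : ContDiff ℝ 2 P.V := hV1.contDiff_two
  have hUc : Continuous P.U := hU.continuous
  have hUm : Measurable P.U := hU.continuous.measurable
  have hVm : Measurable P.V := hV.continuous.measurable
  have hB1 : P.CondB1 :=
    OscillatorChain.condB1_of_bddBelow _ hU hV ⟨0, by rintro _ ⟨q, rfl⟩; exact hU0 q⟩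
      ⟨0, by rintro _ ⟨r, rfl⟩; exact hV0 r⟩
  have hτ : ∀ x : ℤ, MeasurePreserving (chainShift x) μ μ := hS.measurePreserving_chainShift
  have hsev : ∀ (n : ℕ) (t : ℝ), MeasurePreserving
      (OscillatorChain.severedFlow hB1 (Finset.Icc ((0 : ℤ) - n) ((0 : ℤ) + n)) t) μ μ := fun n t =>
    OscillatorChain.measurePreserving_severedFlow_of_isChainGibbsMeasure hU hV hB1 _ hG t
  have hpow4 : ∀ {a : ChainConfig → ℝ}, MemLp a 4 μ → Integrable (fun σ => a σ ^ 4) μ := by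
    intro a h4
    have h := h4.integrable_norm_pow' (p := 4)
    refine h.congr (Eventually.of_forall fun σ => ?_)
    simp only [Real.norm_eq_abs]
    exact Even.pow_abs (by decide) _
  -- the three generators
  set aM : ChainConfig → ℝ := fun σ => max (-M) (min M (P.bondCurrentZ σ 0)) with haM
  set Sg : Set (ChainConfig → ℝ) :=
    {fun σ => P.bondCurrentZ σ 0, fun σ => P.energyDensityZ σ 0, aM} with hSg
  have hgenM : ∀ a ∈ Sg, Measurable a ∧ DependsOn a (Icc (-1 : ℤ) 1) ∧ MemLp a 2 μ := by
    intro a ha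
    rcases ha with rfl | rfl | rfl
    · exact ⟨measurable_bondCurrentZ P 0, P.dependsOn_bondCurrentZ_zero,
        hss.memLp_bondCurrentZ hs₂ hU0 hUm hV1 0 ENNReal.ofNat_ne_top⟩
    · exact ⟨P.measurable_energyDensityZ hUm hVm 0, P.dependsOn_energyDensityZ_zero,
        hss.memLp_energyDensityZ hU0 hV0 hUm hVm 0 ENNReal.ofNat_ne_top⟩
    · exact ⟨measurable_clipCurrent P M 0, dependsOn_clipCurrent P M, memLp_clipCurrent hM.le 0 2⟩
  -- (L) for the three generators
  have hloc : ∀ a ∈ Sg, ∀ τ : ℝ, 0 ≤ τ → ∃ ε : ℕ → ℝ, (∀ n, 0 ≤ ε n) ∧ Summable ε ∧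
      ∀ t : ℝ, |t| ≤ τ → ∀ n : ℕ, ∃ g : ChainConfig → ℝ, DependsOn g (Icc (-(n : ℤ) - 1) (n + 1)) ∧
        Measurable g ∧ MemLp g 2 μ ∧ Real.sqrt (∫ σ, (a (D.flow t σ) - g σ) ^ 2 ∂μ) ≤ ε n := by
    intro a ha τ hτ
    rcases ha with rfl | rfl | rfl
    · obtain ⟨Ca, hCa, hL⟩ := OscillatorChain.exists_polyLipschitz_bondCurrentZ hV1
      obtain ⟨ε, hε0, hε, hmain⟩ := D.exists_summable_l2_locality hs₁ hs₂ hU1 hV1 hcar hB1 hss hD hsev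
        (measurable_bondCurrentZ P 0) P.dependsOn_bondCurrentZ_zero
        (hss.memLp_bondCurrentZ hs₂ hU0 hUm hV1 0 ENNReal.ofNat_ne_top)
        (hpow4 (hss.memLp_bondCurrentZ hs₂ hU0 hUm hV1 0 ENNReal.ofNat_ne_top)) hCa hL τ hτ
      refine ⟨ε, hε0, hε, fun t ht n => ?_⟩
      obtain ⟨h1, h2, h3, h4⟩ := hmain t ht n
      exact ⟨_, h1, h2, h3, h4⟩
    · obtain ⟨Ca, hCa, hL⟩ := OscillatorChain.exists_polyLipschitz_energyDensityZ hU1 hV1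
      obtain ⟨ε, hε0, hε, hmain⟩ := D.exists_summable_l2_locality hs₁ hs₂ hU1 hV1 hcar hB1 hss hD hsev
        (P.measurable_energyDensityZ hUm hVm 0) P.dependsOn_energyDensityZ_zero
        (hss.memLp_energyDensityZ hU0 hV0 hUm hVm 0 ENNReal.ofNat_ne_top)
        (hpow4 (hss.memLp_energyDensityZ hU0 hV0 hUm hVm 0 ENNReal.ofNat_ne_top)) hCa hL τ hτ
      refine ⟨ε, hε0, hε, fun t ht n => ?_⟩
      obtain ⟨h1, h2, h3, h4⟩ := hmain t ht n
      exact ⟨_, h1, h2, h3, h4⟩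
    · exact exists_l2_locality_clipCurrent hs₁ hs₂ hU1 hV1 D hcar hG hss hD hM.le τ hτ
  -- continuity in time of the two-point functions of the three generators
  have hcontS : ∀ a ∈ Sg, ∀ x : ℤ, Continuous fun t : ℝ => ∫ σ, a σ * a (chainShift x (D.flow t σ)) ∂μ := by
    intro a ha x
    rcases ha with rfl | rfl | rfl
    · simp only [OscillatorChain.bondCurrentZ_chainShift]
      exact D.continuous_integral_bondCurrentZ_mul_flow hss hs₂ hU0 hUm hV1 hD (0 + x) 0
    · simp only [OscillatorChain.energyDensityZ_chainShift]
      exact D.continuous_integral_energyDensityZ_mul_flow hss hU0 hUc hV1 hD (0 + x) 0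
    · exact continuous_integral_clipCurrent_mul_flow hV1 D hD hM.le x
  -- summable clustering of the generator pairs, and the data
  have hclust := integrable_cov_generators_of_subset D hU0 hV0 hcar hid hτ hD hC hm hmix Sg hgenM hloc
  obtain ⟨Z, hZμ, hZV⟩ := exists_zeroWavenumberData_of_subset D hU0 hV0 hcar hid hS hD Sg
    (by simp [hSg]) (by simp [hSg]) (fun a ha => (hgenM a ha).2.2) hclust
  subst hZμ
  have hzero : D.flow 0 = id := funext fun σ => D.flow_zero_of_eq_id hcar hid σ
  have hSsub : Sg ⊆ Z.localObs := by
    intro b hb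
    rw [hZV]
    refine Submodule.subset_span ⟨b, hb, 0, 0, ?_⟩
    rw [hzero]
    funext σ
    simp only [comp_apply, id_eq, ShiftAction.apply_zero]
  refine ⟨Z, rfl, hSsub (by simp [hSg]), ?_⟩
  refine Z.toFluctuationDynamics.isStronglyContinuous_of_generators Sg hSsub (le_of_eq hZV) fun a ha => ?_
  obtain ⟨ham, had, ha2⟩ := hgenM a ha
  exact (D.continuous_integral_count_cov_flow hcar hid hU0 hV0 hτ Z.preservesMeasure hC hm hmix ham had ha2
    (hloc a ha) (hcontS a ha)).continuousAt

end Summit.AtomisticToContinuum.FouriersLaw.Theorems.NonBallistic.DrudeFromTruncation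

namespace Summit.AtomisticToContinuum.FouriersLaw.Theorems.NonBallistic

open MeasureTheory ProbabilityTheory Filter Topology
open scoped NNReal ENNReal BigOperators
open Literature.MathematicalPhysics.KineticTheory
open Literature.MathematicalPhysics.KineticTheory.HeatConduction
open Summit.AtomisticToContinuum.FouriersLaw.Theorems.NonBallistic.DrudeFromTruncation

/-- **Registered sub-goal `stub_zeroWavenumberDataClipCurrent`** (stub `stub_drudeFromTruncationRegular`, DFT′, line
`drude-controls-conductance`, R3b): Doyon's zero-wavenumber data with the clipped current `clip_M ∘ j₀` as a local
observable and a strongly continuous Koopman group, for a `𝒳₀`-dynamics in normal form preserving a shift-invariant,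
superstable, exponentially `ρ`-mixing DLR state (`exists_zeroWavenumberData_clipCurrent`, closed form). [folklore] -/
theorem stub_zeroWavenumberDataClipCurrent :
    ∀ (P : OscillatorChain) (s₁ s₂ : ℕ), 1 ≤ s₁ → 1 ≤ s₂ → OscillatorChain.IsEvenPolyOfDegree P.U s₁ → OscillatorChain.IsEvenPolyOfDegree P.V s₂ → ∀ D : InfiniteChainDynamics P, D.carrier = P.bmGood → (∀ (t : ℝ) (σ : ChainConfig), σ ∉ P.bmGood → D.flow t σ = σ) → ∀ (T : ℝ) (μ : Measure ChainConfig), P.IsChainGibbsMeasure T μ → IsShiftInvariant μ → P.HasSuperstabilityEstimate μ → D.PreservesMeasure μ → ∀ C m : ℝ, 0 ≤ C → 0 < m → (∀ (a : ℤ) (n : ℕ) (f g : ChainConfig → ℝ), DependsOn f {i : ℤ | i ≤ a} → DependsOn g {i : ℤ | a + n ≤ i} → Measurable f → Measurable g → MemLp f 2 μ → MemLp g 2 μ → |∫ σ, f σ * g σ ∂μ - (∫ σ, f σ ∂μ) * ∫ σ, g σ ∂μ| ≤ C * Real.exp (-(m * n)) * (∫ σ, f σ ^ 2 ∂μ) ^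 (1 / 2 : ℝ) * (∫ σ, g σ ^ 2 ∂μ) ^ (1 / 2 : ℝ)) → ∀ M : ℝ, 0 < M → ∃ Z : ZeroWavenumberData P D, Z.μ = μ ∧ (fun σ : ChainConfig => max (-M) (min M (P.bondCurrentZ σ 0))) ∈ Z.localObs ∧ Z.toFluctuationDynamics.IsStronglyContinuous :=
  fun _ _ _ hs₁ hs₂ hU1 hV1 D hcar hid _ _ hG hS hss hD _ _ hC hm hmix _ hM =>
    exists_zeroWavenumberData_clipCurrent hs₁ hs₂ hU1 hV1 D hcar hid hG hS hss hD hC hm hmix hM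

end Summit.AtomisticToContinuum.FouriersLaw.Theorems.NonBallistic

end
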